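import Mathlib.Tactic.Linarith
import Mathlib.Tactic.NormNum
import Mathlib.Tactic.Ring
import Mathlib.Tactic.LinearCombination
import Mathlib.Algebra.BigOperators.Group.Finset.Basic
import Mathlib.Data.ZMod.Basic
import HarnessLib

/-!
# The (0,1) cell of the ι-window, XXVII-B: the product ground `B₁ × B₂`, XIV (ADDENDUM 1) — the NODE AXIS: the Künneth rows of the hull on the
# normalisation, `r = 1` forced, the toric point `P_q`, the `R¹`-table (report [XXVII] §14): arithmetic shadows

Family `hodge`, b2b cell `hweil` (helper of item stmt-HodgeConjecture-2524). Companion (`pg14a_*`) of `WeilTypeLadderH2ProductGroundFourteen.lean`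
(same seat). Report `run/shared/lean/b2b/hodge-weil/b2b-hweil-pv1-g39/H2-ZERO-ONE-27.md` ([XXVII]) §14 (ADDENDUM 1); script
`code/pv1-g39/node_axis.py`. HONEST FRAMING: census results inside the ladder's H2 test ((0,1) cell) on the SPECIAL fourfold `X₀ = B₁ × B₂`; nothing
here is a rung; no case of the Hodge conjecture is proved; no statement of [Markman 2025] / [Perry 2026] / [EdGFS 2025] is used. Every theorem is a
def-free arithmetic identity that the report cites at the step named in its docstring; none claims geometry.
-/

-- mandated namespace `Summit.HodgeConjecture.HodgeConjecture.…` (Problem = Summit) trips `linter.dupNamespace`; the lakefile disables it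
-- tree-wide (weak option), restated here so stand-alone elaboration is warning-free too.
set_option linter.dupNamespace false

open Finset

namespace Summit.HodgeConjecture.HodgeConjecture.WeilTypeLadder

section ProductGroundFourteenAdd1

/-- **LEMMA N-PAR ([XXVII] 14.2): the gluing rank is odd.** On a node-axis support the Künneth value of the `(pt₁,1)` entry of the hull is
`(4a₁ − 4) + (2v_w + 1) + 2(x₃ + x₄) = 4a₁ − 3 + 2(v_w + x₃ + x₄)` (the blow-up at `w` contributes `v_w(v_w−1)/2 − (v_w+2)(v_w+1)/2 = −2v_w − 1`), an
ODD integer; the H2 class has `2` there and the only correction is the rank `r` of the gluing module on `V_w = {w} × B₂`: so `r` is odd, i.e.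
`r = 1` (it is `≤ 1`), and then `v_w + x₃ + x₄ = 3 − 2a₁`. Also the blow-up identity, doubled. [`ring` / `omega`] -/
theorem pg14a_gluing_rank_odd :
    (∀ v : ℤ, v * (v - 1) - (v + 2) * (v + 1) = 2 * (-2 * v - 1)) ∧
    (∀ a v x₃ x₄ r : ℤ, (4 * a - 3 + 2 * (v + x₃ + x₄)) - r = 2 → 0 ≤ r → r ≤ 1 → r = 1 ∧ v + x₃ + x₄ = 3 - 2 * a) := by
  refine ⟨fun v => by ring, ?_⟩
  intro a v x₃ x₄ r h h0 h1
  omega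

/-- **LEMMA N-PAR ([XXVII] 14.2), the B₂ side is CS2 verbatim.** With `Σy = S = 3 − 2a₂` over the four base pairs and `T = Σy²`, the `(θ₁,pt₂)`
entry of the hull is `u = 2(a₂² − 3a₂ + 4) − 2T`; Cauchy–Schwarz `4T ≥ S²` gives `u ≤ 3`, and `a₂² − 3a₂ = a₂(a₂ − 3)` is even while `T ≡ S` is odd, so
`u ≡ 2 (mod 4)`: `u = 2`, `T = a₂² − 3a₂ + 3`, pattern `(k,k,k,k±1)` — as [XXV] 2.1. Here: the inequality and the parity of `a(a−3)` (over `ZMod 2`).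
[`nlinarith` / `decide`] -/
theorem pg14a_B2_side_is_CS2 :
    (∀ a₂ T : ℤ, (3 - 2 * a₂) ^ 2 ≤ 4 * T → 2 * (a₂ ^ 2 - 3 * a₂ + 4) - 2 * T ≤ 3) ∧ (∀ a : ZMod 2, a * (a - 3) = 0) := by
  refine ⟨?_, by decide⟩
  intro a₂ T h
  nlinarith

/-- **[XXVII] 14.3 (the B₁-side residual), the closed form.** With `a₂ = 3 − a₁` and the (pt₁,1)-constraint `v_w + x₃ + x₄ = 3 − 2a₁`, the `(pt₁,θ₂)`
entry `a₂·3 + 2s₁′`, `s₁′ = (a₁−2)² − (v_w+2)(v_w+1)/2 − (x₃+1)x₃ − (x₄+1)x₄`, equals `2a₁² − 7a₁ + 9 − v_w(v_w+1) − 2(x₃² + x₄²)` (stated doubled,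
division-free). [`linear_combination`] -/
theorem pg14a_B1_side_closed_form (a v x₃ x₄ : ℤ) (h : v + x₃ + x₄ = 3 - 2 * a) :
    6 * (3 - a) + 4 * (a - 2) ^ 2 - 2 * (v + 2) * (v + 1) - 4 * (x₃ + 1) * x₃ - 4 * (x₄ + 1) * x₄ =
      2 * (2 * a ^ 2 - 7 * a + 9 - v * (v + 1) - 2 * (x₃ ^ 2 + x₄ ^ 2)) := by
  linear_combination (-4) * h

/-- **LEMMA N-TOR ([XXVII] 14.4): the toric point `P_q`.** The cone `σ = ⟨r₁,r₂,r₃,r₄⟩`, `r₁ = (1,0,0)`, `r₂ = (0,1,0)` (`= Ṽ_w`), `r₃ = (0,0,1)` (`= H̃_q`),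
`r₄ = (−1,1,2)`: the relation `r₁ + r₄ = r₂ + 2r₃` (componentwise), the two cones of the small resolution are unimodular (`det⟨r₁,r₂,r₃⟩ = 1`,
`det⟨r₂,r₃,r₄⟩ = 0·(0·2−1·1) − 1·(0·2−1·(−1)) + 0 = −1`), the class-group functional `(d₁,d₂,d₃,d₄) ↦ d₁ − d₂ − 2d₃ + d₄` kills the principal divisors
`div χ^{e₁} = (1,0,0,−1)`, `div χ^{e₂} = (0,1,0,1)`, `div χ^{e₃} = (0,0,1,2)` and takes the value `1` on `D₄` (`Cl(P_q) ≅ ℤ`, torsion-free: NOT ℚ-factorial),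
and the wall relation gives `D₂·ℓ_q = −1`, `D₃·ℓ_q = −2` (normal bundle `𝒪(−1) ⊕ 𝒪(−2)`, `ℓ_q² = 2·(−1) = −2` inside `Ṽ_w`), so `deg 𝒪(v_wṼ_w + h_qH̃_q)|_{ℓ_q}
= −v_w − 2h_q`. [`norm_num`] -/
theorem pg14a_toric_point :
    ((1:ℤ) + (-1) = 0 + 2 * 0 ∧ (0:ℤ) + 1 = 1 + 2 * 0 ∧ (0:ℤ) + 2 = 0 + 2 * 1) ∧
    ((0:ℤ) * (0 * 2 - 1 * 1) - 1 * (0 * 2 - 1 * (-1)) + 0 * (0 * 1 - 0 * (-1)) = -1) ∧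
    ((1:ℤ) - 0 - 2 * 0 + (-1) = 0 ∧ (0:ℤ) - 1 - 2 * 0 + 1 = 0 ∧ (0:ℤ) - 0 - 2 * 1 + 2 = 0 ∧ (0:ℤ) - 0 - 2 * 0 + 1 = 1) ∧
    (∀ v h : ℤ, v * (-1) + h * (-2) = -v - 2 * h) ∧ (2 * (-1) = (-2:ℤ)) := by
  refine ⟨by norm_num, by norm_num, by norm_num, fun v h => by ring, by norm_num⟩

/-- **[XXVII] 14.4 (the `R¹`-table at `P_q`), closed form.** For a smooth rational curve with normal bundle `𝒪(−1) ⊕ 𝒪(−2)` and a line bundle of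
degree `d` on it, the formal-neighbourhood count `λ(d) = Σ_{i,j ≥ 0} max(0, −d − 1 − i − 2j)` — which the exact toric Čech table of `node_axis.py`
reproduces for `−9 ≤ d ≤ 9` — takes the values `1, 3, 7, 13, 22, 34, 50, 70` at `d = −2, …, −9` (and `0` for `d ≥ −1`). Here in `ℕ` with truncated
subtraction (`n = −d`). [`decide`] -/
theorem pg14a_R1_table :
    (((range 12).sum fun i => (range 12).sum fun j => (2 - 1 - i - 2 * j)) = 1) ∧
    (((range 12).sum fun i => (range 12).sum fun j => (3 - 1 - i - 2 * j)) = 3) ∧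
    (((range 12).sum fun i => (range 12).sum fun j => (4 - 1 - i - 2 * j)) = 7) ∧
    (((range 12).sum fun i => (range 12).sum fun j => (5 - 1 - i - 2 * j)) = 13) ∧
    (((range 12).sum fun i => (range 12).sum fun j => (6 - 1 - i - 2 * j)) = 22) ∧
    (((range 12).sum fun i => (range 12).sum fun j => (7 - 1 - i - 2 * j)) = 34) ∧
    (((range 12).sum fun i => (range 12).sum fun j => (8 - 1 - i - 2 * j)) = 50) ∧
    (((range 12).sum fun i => (range 12).sum fun j => (9 - 1 - i - 2 * j)) = 70) ∧
    (((range 12).sum fun i => (range 12).sum fun j => (1 - 1 - i - 2 * j)) = 0) := by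
  refine ⟨by decide, by decide, by decide, by decide, by decide, by decide, by decide, by decide, by decide⟩

/-- **[XXVII] 14.2 / 14.5 (the fibre relation and the conductor cover).** The shift `(a₁, v_w, x₃, x₄; a₂, y) ↦ (a₁+2, v_w−2, x₃−1, x₄−1; a₂−2, y+1)`
(adding `f₁ − f₂ ≡ 0`, `f₁ = 2θ₁ − 2e_w − Σe_p`) preserves the constraints `v_w + x₃ + x₄ = 3 − 2a₁` and `Σy = 3 − 2a₂`; the conductor cover `C̃ → B₂`
is a double cover branched along two members `D₁ + D₂ ≡ 4θ₂` meeting in the `D₁·D₂ = 2·2·2 = 8` base points, over which `C̃` has `A₁` points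
(`ℓ_q² = −2`); the half-fibre class satisfies `2η = δ^*f₂` while `δ_*η = f₂` has odd intersection `f₂·e_q = 1` with a section, so `η` is not a
pull-back. [`omega` / `norm_num`] -/
theorem pg14a_fibre_relation_and_cover :
    (∀ a v x₃ x₄ : ℤ, v + x₃ + x₄ = 3 - 2 * a → (v - 2) + (x₃ - 1) + (x₄ - 1) = 3 - 2 * (a + 2)) ∧
    (∀ a₂ y₁ y₂ y₃ y₄ : ℤ, y₁ + y₂ + y₃ + y₄ = 3 - 2 * a₂ → (y₁ + 1) + (y₂ + 1) + (y₃ + 1) + (y₄ + 1) = 3 - 2 * (a₂ - 2)) ∧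
    (2 * 2 * 2 = (8:ℤ)) ∧ (2 + 2 = (4:ℤ)) ∧ (∀ L : ℤ, 2 * L ≠ 1) := by
  refine ⟨?_, ?_, by norm_num, by norm_num, ?_⟩
  · intro a v x₃ x₄ h; omega
  · intro a₂ y₁ y₂ y₃ y₄ h; omega
  · intro L; omega

end ProductGroundFourteenAdd1

end Summit.HodgeConjecture.HodgeConjecture.WeilTypeLadder
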